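import Summits.CriticalPhenomena.SAWScalingLimit.Theses.SAWLoopFugacityFlow
import Summits.CriticalPhenomena.SAWScalingLimit.Theorems.IsingBoundaryRatio.Negative.IsingBoundaryRatioNormalisation
import Literature.Probability.LatticeModels.PlanarIsingOnePointProofs
import Literature.Probability.RandomPlanarGeometry.ChordalCapacityDivergence
import Literature.Probability.RandomPlanarGeometry.HullSubdomainPullback
import Literature.Analysis.Complex.InjectiveHolomorphic

/-!
# Boundary fusion of CHI's free two-point functions for a hull subdomain

Stub `stub_boundaryFusionCore` of the line `fk-anchor-transfer` for the crux `IsingBoundaryRatio`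
(stmt-CriticalPhenomena-10650). For nested Dobrushin domains `D' ⊆ D` with common marked points
`a, b`, a chordal uniformizer `φ : (ℍ; 0, ∞) → (D; a, b)`, the pulled-back `*`-hull
`A = closure (ℍ ∖ φ⁻¹ D')` and its restriction map `Φ = Φ_A` (`Φ'_A(0) = d`), the ratio of CHI's
explicit continuum free Ising two-point functions ([CHI15] Thm. 1.1, eqs. (1.2)–(1.3)) of `D'`
(chart `Φ ∘ φ⁻¹`) and of `D` (chart `φ⁻¹`) tends to `d^{1/2}` as `(z, w) → (a, b)` inside `D'`,
GIVEN the first-order behaviour of `Φ` at `0` (`Im Φζ/Im ζ → d`, `Φ'ζ → d`) and at `∞`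
(`Im Φξ/Im ξ → 1`, `Φ'ξ → 1`). In the coordinates `ζ = φ⁻¹ z → 0`, `ξ = φ⁻¹ w → ∞`
(Carathéodory) the free numerator of (1.3) is `u⁻¹ - u = 4 Im ζ Im ξ / (‖ξ - ζ̄‖² u (1 + u²))`,
the chart derivative `(φ⁻¹)'` cancels by the chain rule, and the ratio is
`d^{1/2} · d^{-1/8} · d^{1/8} = d^{1/2}` in the limit.

Reference: D. Chelkak, C. Hongler, K. Izyurov, *Conformal invariance of spin correlations in
the planar Ising model*, Ann. of Math. 181 (2015), Thm. 1.1 and eqs. (1.2)–(1.3).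
-/

noncomputable section

open scoped Topology ComplexConjugate
open Filter Set Metric Complex
open Literature.Probability.LatticeModels Literature.Probability.RandomPlanarGeometry
open UpperHalfPlane (upperHalfPlaneSet)

namespace Summit.CriticalPhenomena.SAWScalingLimit.Theorems.IsingBoundaryRatio

open Summit.CriticalPhenomena.SAWScalingLimit.Theorems.IsingBoundaryRatio.Negative

/-! ### The free half-plane numerator `u⁻¹ - u` in closed form -/

/-- Two points of `ℍ` are not complex conjugate: `Q ≠ P̄`. [folklore] -/
theorem ne_conj_of_im_pos {P Q : ℂ} (hP : 0 < P.im) (hQ : 0 < Q.im) : Q ≠ conj P := by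
  intro h
  have := congrArg Complex.im h
  simp only [conj_im] at this
  linarith

/-- **The free half-plane numerator in closed form.** For `P ≠ Q` in `ℍ`, with CHI's
`u = u_{PQ} = (‖Q - P‖ / ‖Q - P̄‖)^{1/2}`: `u⁻¹ - u = 4 Im P Im Q / (‖Q - P̄‖² · u · (1 + u²))`
(from `‖Q - P̄‖² = ‖Q - P‖² + 4 Im P Im Q`). [cite: ChelkakHonglerIzyurovAnnals2015, eq. (1.3)] -/
theorem inv_uCHI_sub_uCHI {P Q : ℂ} (hP : 0 < P.im) (hQ : 0 < Q.im) (hPQ : P ≠ Q) :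
    (uCHI P Q)⁻¹ - uCHI P Q =
      4 * P.im * Q.im / (‖Q - conj P‖ ^ 2 * (uCHI P Q * (1 + uCHI P Q ^ 2))) := by
  set N := ‖Q - P‖ with hN
  set M := ‖Q - conj P‖ with hM
  have hN0 : 0 < N := norm_pos_iff.2 (sub_ne_zero.2 (Ne.symm hPQ))
  have hM0 : 0 < M := norm_pos_iff.2 (sub_ne_zero.2 (ne_conj_of_im_pos hP hQ))
  have hsq : M ^ 2 = N ^ 2 + 4 * P.im * Q.im := by
    simp only [hM, hN]
    rw [← normSq_eq_norm_sq, ← normSq_eq_norm_sq]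
    simp only [normSq_apply, sub_re, conj_re, sub_im, conj_im]
    ring
  have hu : uCHI P Q = Real.sqrt (N / M) := by
    unfold uCHI
    rw [Real.sqrt_eq_rpow]
  set u := uCHI P Q with hu'
  have hu0 : 0 < u := by rw [hu]; exact Real.sqrt_pos.2 (div_pos hN0 hM0)
  have hu2 : u ^ 2 = N / M := by rw [hu]; exact Real.sq_sqrt (div_pos hN0 hM0).le
  have h4 : 4 * P.im * Q.im = M ^ 2 - N ^ 2 := by linarith
  rw [h4, hu2]
  have hMN : M + N ≠ 0 := by positivity
  have key : u⁻¹ - u = (1 - u ^ 2) / u := by field_simp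
  rw [key, hu2]
  field_simp
  ring

/-! ### The chain rule cancels the chart derivative in the ratio -/

/-- **The chart derivative cancels.** If `(Φ ∘ ψ)' = Φ'(ψ ·) · ψ'` at `z` and `w` with
`ψ'(z), ψ'(w) ≠ 0`, the ratio of CHI's free two-point functions written in the charts `Φ ∘ ψ`
and `ψ` is `√(u'⁻¹ - u')/√(u⁻¹ - u) · [(2 Im ψz)^{1/8} (2 Im ψw)^{1/8} / ((2 Im Φψz)^{1/8}
(2 Im Φψw)^{1/8})] · |Φ'(ψ z)|^{1/8} |Φ'(ψ w)|^{1/8}` (covariance (1.2) of degree `1/8`).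
[cite: ChelkakHonglerIzyurovAnnals2015, Thm. 1.1 with eqs. (1.2)–(1.3)] -/
theorem twoPointFreeCHI_comp_div_eq {Φf ψf : ℂ → ℂ} {z w : ℂ}
    (hz : deriv (fun x => Φf (ψf x)) z = deriv Φf (ψf z) * deriv ψf z)
    (hw : deriv (fun x => Φf (ψf x)) w = deriv Φf (ψf w) * deriv ψf w)
    (hz0 : deriv ψf z ≠ 0) (hw0 : deriv ψf w ≠ 0) :
    twoPointFreeCHI (fun x => Φf (ψf x)) z w / twoPointFreeCHI ψf z w =
      Real.sqrt ((uCHI (Φf (ψf z)) (Φf (ψf w)))⁻¹ - uCHI (Φf (ψf z)) (Φf (ψf w))) /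
          Real.sqrt ((uCHI (ψf z) (ψf w))⁻¹ - uCHI (ψf z) (ψf w)) *
        ((2 * (ψf z).im) ^ ((1 : ℝ) / 8) * (2 * (ψf w).im) ^ ((1 : ℝ) / 8) /
          ((2 * (Φf (ψf z)).im) ^ ((1 : ℝ) / 8) * (2 * (Φf (ψf w)).im) ^ ((1 : ℝ) / 8))) *
        (‖deriv Φf (ψf z)‖ ^ ((1 : ℝ) / 8) * ‖deriv Φf (ψf w)‖ ^ ((1 : ℝ) / 8)) := by
  unfold twoPointFreeCHI
  rw [hz, hw, norm_mul, norm_mul, Real.mul_rpow (norm_nonneg _) (norm_nonneg _),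
    Real.mul_rpow (norm_nonneg _) (norm_nonneg _)]
  set k₁ := ‖deriv ψf z‖ ^ ((1 : ℝ) / 8) with hk₁
  set k₂ := ‖deriv ψf w‖ ^ ((1 : ℝ) / 8) with hk₂
  have hK : k₁ * k₂ ≠ 0 :=
    (mul_pos (Real.rpow_pos_of_pos (norm_pos_iff.2 hz0) _)
      (Real.rpow_pos_of_pos (norm_pos_iff.2 hw0) _)).ne'
  rw [show ∀ A a b : ℝ, A * (a * k₁ * (b * k₂)) = A * (a * b) * (k₁ * k₂) from
    fun A a b => by ring, mul_div_mul_right _ _ hK, div_div_eq_mul_div]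
  ring

/-! ### Elementary limits along `ξ → ∞` -/

variable {α : Type*} {l : Filter α}

/-- `ξ → ∞` and `f → c` force `f / ξ → 0`. [folklore] -/
theorem tendsto_div_of_tendsto_cocompact {f ξ : α → ℂ} {c : ℂ} (hf : Tendsto f l (𝓝 c))
    (h : Tendsto ξ l (cocompact ℂ)) : Tendsto (fun t => f t / ξ t) l (𝓝 0) := by
  rw [← Metric.cobounded_eq_cocompact] at h
  simpa [div_eq_mul_inv] using hf.mul (tendsto_inv₀_cobounded.comp h)

/-- `ξ → ∞`: eventually `ξ ≠ 0`. [folklore] -/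
theorem eventually_ne_zero_of_tendsto_cocompact {ξ : α → ℂ} (h : Tendsto ξ l (cocompact ℂ)) :
    ∀ᶠ t in l, ξ t ≠ 0 := by
  filter_upwards [(tendsto_norm_cocompact_atTop.comp h).eventually_ge_atTop 1] with t ht h0
  rw [Function.comp_apply, h0, norm_zero] at ht
  exact absurd ht (by norm_num)

/-- `ξ'/ξ → 1` and `ξ → ∞` force `‖ξ'‖ → ∞`. [folklore] -/
theorem tendsto_norm_atTop_of_div {ξ ξ' : α → ℂ} (h7 : Tendsto (fun t => ξ' t / ξ t) l (𝓝 1))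
    (h8 : Tendsto ξ l (cocompact ℂ)) : Tendsto (fun t => ‖ξ' t‖) l atTop := by
  have h1 : Tendsto (fun t => ‖ξ' t / ξ t‖) l (𝓝 1) := by simpa using h7.norm
  have h : Tendsto (fun t => ‖ξ' t / ξ t‖ * ‖ξ t‖) l atTop :=
    h1.pos_mul_atTop one_pos (tendsto_norm_cocompact_atTop.comp h8)
  refine h.congr' ?_
  filter_upwards [eventually_ne_zero_of_tendsto_cocompact h8] with t ht
  rw [norm_div, div_mul_cancel₀ _ (norm_ne_zero_iff.2 ht)]

/-- A point tending to `0` and a point tending to `∞` are eventually distinct. [folklore] -/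
theorem eventually_ne_of_tendsto_zero_atTop {ζ ξ : α → ℂ} (h5 : Tendsto ζ l (𝓝 0))
    (h : Tendsto (fun t => ‖ξ t‖) l atTop) : ∀ᶠ t in l, ζ t ≠ ξ t := by
  filter_upwards [Metric.tendsto_nhds.1 h5 1 one_pos, h.eventually_ge_atTop 1] with t h1t h2t heq
  rw [dist_zero_right, heq] at h1t
  linarith

/-- Scaling out `ξ ≠ 0` from a distance: `‖a - v‖ = ‖ξ‖ · ‖a/ξ - v/ξ‖`. [folklore] -/
theorem norm_sub_eq_norm_mul_norm_div_sub_div {ξ : ℂ} (hξ : ξ ≠ 0) (a v : ℂ) :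
    ‖a - v‖ = ‖ξ‖ * ‖a / ξ - v / ξ‖ := by
  rw [← norm_mul, mul_sub, mul_div_cancel₀ a hξ, mul_div_cancel₀ v hξ]

/-- `p/ξ → 0` forces `p̄/ξ → 0`. [folklore] -/
theorem tendsto_conj_div_of_tendsto_div {p ξ : α → ℂ} (hp : Tendsto (fun t => p t / ξ t) l (𝓝 0)) :
    Tendsto (fun t => conj (p t) / ξ t) l (𝓝 0) := by
  rw [tendsto_zero_iff_norm_tendsto_zero] at hp ⊢
  simpa only [norm_div, Complex.norm_conj] using hp

/-- `‖q - p̄‖ / ‖ξ‖ → 1` when `p/ξ → 0` and `q/ξ → 1`. [folklore] -/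
theorem tendsto_norm_sub_conj_div_norm {p q ξ : α → ℂ} (hp : Tendsto (fun t => p t / ξ t) l (𝓝 0))
    (hq : Tendsto (fun t => q t / ξ t) l (𝓝 1)) (hξ : ∀ᶠ t in l, ξ t ≠ 0) :
    Tendsto (fun t => ‖q t - conj (p t)‖ / ‖ξ t‖) l (𝓝 1) := by
  have h : Tendsto (fun t => ‖q t / ξ t - conj (p t) / ξ t‖) l (𝓝 1) := by
    simpa using (hq.sub (tendsto_conj_div_of_tendsto_div hp)).norm
  refine h.congr' ?_
  filter_upwards [hξ] with t ht
  rw [norm_sub_eq_norm_mul_norm_div_sub_div ht (q t),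
    mul_div_cancel_left₀ _ (norm_ne_zero_iff.2 ht)]

/-- **`u_{pq} → 1`** when, on the scale of `ξ → ∞`, `p/ξ → 0` and `q/ξ → 1`
(`u_{pq} = (‖q/ξ - p/ξ‖ / ‖q/ξ - p̄/ξ‖)^{1/2} → 1`).
[cite: ChelkakHonglerIzyurovAnnals2015, eq. (1.3)] -/
theorem tendsto_uCHI_one_of_div {p q ξ : α → ℂ} (hp : Tendsto (fun t => p t / ξ t) l (𝓝 0))
    (hq : Tendsto (fun t => q t / ξ t) l (𝓝 1)) (hξ : ∀ᶠ t in l, ξ t ≠ 0) :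
    Tendsto (fun t => uCHI (p t) (q t)) l (𝓝 1) := by
  have hn : Tendsto (fun t => ‖q t / ξ t - p t / ξ t‖) l (𝓝 1) := by
    simpa using (hq.sub hp).norm
  have hm : Tendsto (fun t => ‖q t / ξ t - conj (p t) / ξ t‖) l (𝓝 1) := by
    simpa using (hq.sub (tendsto_conj_div_of_tendsto_div hp)).norm
  have h : Tendsto (fun t => (‖q t / ξ t - p t / ξ t‖ / ‖q t / ξ t - conj (p t) / ξ t‖) ^
      ((1 : ℝ) / 2)) l (𝓝 1) := by
    have := (hn.div hm one_ne_zero).rpow_const (p := (1 : ℝ) / 2) (Or.inr (by norm_num))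
    simpa using this
  refine h.congr' ?_
  filter_upwards [hξ] with t ht
  unfold uCHI
  rw [norm_sub_eq_norm_mul_norm_div_sub_div ht (q t) (p t),
    norm_sub_eq_norm_mul_norm_div_sub_div ht (q t) (conj (p t)),
    mul_div_mul_left _ _ (norm_ne_zero_iff.2 ht)]

/-! ### The limit of the ratio of the free numerators -/

/-- **Ratio of the free numerators.** Along a filter with `ζ → 0`, `ζ' → 0`, `ξ → ∞`,
`ξ'/ξ → 1`, `Im ζ'/Im ζ → d`, `Im ξ'/Im ξ → 1` (all four points in `ℍ`):
`(u'⁻¹ - u') / (u⁻¹ - u) → d`, where `u = u_{ζξ}`, `u' = u_{ζ'ξ'}` — by the closed form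
`u⁻¹ - u = 4 Im ζ Im ξ / (‖ξ - ζ̄‖² u (1 + u²))` with `u, u' → 1` and `‖ξ - ζ̄‖ / ‖ξ' - ζ̄'‖ → 1`.
[cite: ChelkakHonglerIzyurovAnnals2015, eq. (1.3)] -/
theorem tendsto_invSub_div_invSub {ζ ξ ζ' ξ' : α → ℂ} {d : ℝ}
    (h1 : Tendsto (fun t => (ζ' t).im / (ζ t).im) l (𝓝 d))
    (h3 : Tendsto (fun t => (ξ' t).im / (ξ t).im) l (𝓝 1))
    (h5 : Tendsto ζ l (𝓝 0)) (h6 : Tendsto ζ' l (𝓝 0))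
    (h7 : Tendsto (fun t => ξ' t / ξ t) l (𝓝 1)) (h8 : Tendsto ξ l (cocompact ℂ))
    (hζ : ∀ᶠ t in l, 0 < (ζ t).im) (hξ : ∀ᶠ t in l, 0 < (ξ t).im)
    (hζ' : ∀ᶠ t in l, 0 < (ζ' t).im) (hξ' : ∀ᶠ t in l, 0 < (ξ' t).im) :
    Tendsto (fun t => ((uCHI (ζ' t) (ξ' t))⁻¹ - uCHI (ζ' t) (ξ' t)) /
        ((uCHI (ζ t) (ξ t))⁻¹ - uCHI (ζ t) (ξ t))) l (𝓝 d) := by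
  have hne := eventually_ne_zero_of_tendsto_cocompact h8
  have hζξ := eventually_ne_of_tendsto_zero_atTop h5 (tendsto_norm_cocompact_atTop.comp h8)
  have hζξ' := eventually_ne_of_tendsto_zero_atTop h6 (tendsto_norm_atTop_of_div h7 h8)
  have hq0 : Tendsto (fun t => ξ t / ξ t) l (𝓝 1) :=
    tendsto_const_nhds.congr' (by filter_upwards [hne] with t ht; exact (div_self ht).symm)
  have hp0 := tendsto_div_of_tendsto_cocompact h5 h8
  have hp1 := tendsto_div_of_tendsto_cocompact h6 h8
  have hu0 := tendsto_uCHI_one_of_div hp0 hq0 hne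
  have hu1 := tendsto_uCHI_one_of_div hp1 h7 hne
  have hMM : Tendsto (fun t => ‖ξ t - conj (ζ t)‖ / ‖ξ' t - conj (ζ' t)‖) l (𝓝 1) := by
    have h := (tendsto_norm_sub_conj_div_norm hp0 hq0 hne).div
      (tendsto_norm_sub_conj_div_norm hp1 h7 hne) one_ne_zero
    rw [div_one] at h
    refine h.congr' ?_
    filter_upwards [hne] with t ht
    simp only [Pi.div_apply]
    rw [div_div_div_cancel_right₀ (norm_ne_zero_iff.2 ht)]
  have hlim : Tendsto (fun t => (ζ' t).im / (ζ t).im * ((ξ' t).im / (ξ t).im) *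
      ((‖ξ t - conj (ζ t)‖ / ‖ξ' t - conj (ζ' t)‖) ^ 2 *
        (uCHI (ζ t) (ξ t) * (1 + uCHI (ζ t) (ξ t) ^ 2) /
          (uCHI (ζ' t) (ξ' t) * (1 + uCHI (ζ' t) (ξ' t) ^ 2))))) l (𝓝 d) := by
    have h := (h1.mul h3).mul ((hMM.pow 2).mul
      ((hu0.mul ((tendsto_const_nhds (x := (1 : ℝ))).add (hu0.pow 2))).div
        (hu1.mul ((tendsto_const_nhds (x := (1 : ℝ))).add (hu1.pow 2)))
        (by norm_num : (1 : ℝ) * (1 + 1 ^ 2) ≠ 0)))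
    have hc : d * 1 * (1 ^ 2 * (1 * (1 + 1 ^ 2) / (1 * (1 + 1 ^ 2)))) = d := by norm_num
    rw [hc] at h
    exact h
  refine hlim.congr' ?_
  filter_upwards [hζ, hξ, hζ', hξ', hζξ, hζξ'] with t h1t h2t h3t h4t h5t h6t
  rw [inv_uCHI_sub_uCHI h1t h2t h5t, inv_uCHI_sub_uCHI h3t h4t h6t]
  have i1 : (ζ t).im ≠ 0 := h1t.ne'
  have i2 : (ξ t).im ≠ 0 := h2t.ne'
  have i3 : ‖ξ t - conj (ζ t)‖ ≠ 0 := norm_ne_zero_iff.2 (sub_ne_zero.2 (ne_conj_of_im_pos h1t h2t))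
  have i4 : ‖ξ' t - conj (ζ' t)‖ ≠ 0 :=
    norm_ne_zero_iff.2 (sub_ne_zero.2 (ne_conj_of_im_pos h3t h4t))
  have i5 : uCHI (ζ t) (ξ t) ≠ 0 := (uCHI_pos (Ne.symm h5t) (ne_conj_of_im_pos h1t h2t)).ne'
  have i6 : uCHI (ζ' t) (ξ' t) ≠ 0 := (uCHI_pos (Ne.symm h6t) (ne_conj_of_im_pos h3t h4t)).ne'
  field_simp

/-! ### The boundary fusion limit in half-plane coordinates -/

/-- **Boundary fusion in half-plane coordinates.** Along a filter with `ζ → 0`, `ζ' → 0`,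
`ξ → ∞`, `ξ'/ξ → 1`, `Im ζ'/Im ζ → d > 0`, `Im ξ'/Im ξ → 1`, and "derivative" values
`D₁ → d`, `D₂ → 1`, the product
`√(u'⁻¹ - u')/√(u⁻¹ - u) · [(2 Im ζ)^{1/8} (2 Im ξ)^{1/8} / ((2 Im ζ')^{1/8} (2 Im ξ')^{1/8})] ·
|D₁|^{1/8} |D₂|^{1/8}` (the ratio of CHI's free half-plane two-point functions (1.3) with the
covariance factor (1.2) of the intermediate chart) tends to
`d^{1/2} · d^{-1/8} · d^{1/8} = d^{1/2}`.
[cite: ChelkakHonglerIzyurovAnnals2015, Thm. 1.1 with eqs. (1.2)–(1.3)] -/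
theorem tendsto_freeRatio_halfPlane {ζ ξ ζ' ξ' D₁ D₂ : α → ℂ} {d : ℝ} (hd : 0 < d)
    (h1 : Tendsto (fun t => (ζ' t).im / (ζ t).im) l (𝓝 d))
    (h2 : Tendsto D₁ l (𝓝 (d : ℂ)))
    (h3 : Tendsto (fun t => (ξ' t).im / (ξ t).im) l (𝓝 1))
    (h4 : Tendsto D₂ l (𝓝 1))
    (h5 : Tendsto ζ l (𝓝 0)) (h6 : Tendsto ζ' l (𝓝 0))
    (h7 : Tendsto (fun t => ξ' t / ξ t) l (𝓝 1)) (h8 : Tendsto ξ l (cocompact ℂ))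
    (hζ : ∀ᶠ t in l, 0 < (ζ t).im) (hξ : ∀ᶠ t in l, 0 < (ξ t).im)
    (hζ' : ∀ᶠ t in l, 0 < (ζ' t).im) (hξ' : ∀ᶠ t in l, 0 < (ξ' t).im) :
    Tendsto (fun t =>
      Real.sqrt ((uCHI (ζ' t) (ξ' t))⁻¹ - uCHI (ζ' t) (ξ' t)) /
            Real.sqrt ((uCHI (ζ t) (ξ t))⁻¹ - uCHI (ζ t) (ξ t)) *
          ((2 * (ζ t).im) ^ ((1 : ℝ) / 8) * (2 * (ξ t).im) ^ ((1 : ℝ) / 8) /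
            ((2 * (ζ' t).im) ^ ((1 : ℝ) / 8) * (2 * (ξ' t).im) ^ ((1 : ℝ) / 8))) *
        (‖D₁ t‖ ^ ((1 : ℝ) / 8) * ‖D₂ t‖ ^ ((1 : ℝ) / 8))) l (𝓝 (d ^ ((1 : ℝ) / 2))) := by
  have hζξ := eventually_ne_of_tendsto_zero_atTop h5 (tendsto_norm_cocompact_atTop.comp h8)
  -- the three factors
  have hA : Tendsto (fun t => Real.sqrt ((uCHI (ζ' t) (ξ' t))⁻¹ - uCHI (ζ' t) (ξ' t)) /
      Real.sqrt ((uCHI (ζ t) (ξ t))⁻¹ - uCHI (ζ t) (ξ t))) l (𝓝 (Real.sqrt d)) := by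
    refine (tendsto_invSub_div_invSub h1 h3 h5 h6 h7 h8 hζ hξ hζ' hξ').sqrt.congr' ?_
    filter_upwards [hζ, hξ, hζξ] with t h1t h2t h3t
    have := uCHI_nonneg (ζ t) (ξ t)
    exact Real.sqrt_div' _ (by rw [inv_uCHI_sub_uCHI h1t h2t h3t]; positivity)
  have hB : Tendsto (fun t => (2 * (ζ t).im) ^ ((1 : ℝ) / 8) * (2 * (ξ t).im) ^ ((1 : ℝ) / 8) /
      ((2 * (ζ' t).im) ^ ((1 : ℝ) / 8) * (2 * (ξ' t).im) ^ ((1 : ℝ) / 8))) l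
      (𝓝 ((d⁻¹ * 1⁻¹) ^ ((1 : ℝ) / 8))) := by
    have h1' : Tendsto (fun t => (ζ t).im / (ζ' t).im) l (𝓝 d⁻¹) := by
      simpa only [inv_div] using h1.inv₀ hd.ne'
    have h3' : Tendsto (fun t => (ξ t).im / (ξ' t).im) l (𝓝 1⁻¹) := by
      simpa only [inv_div] using h3.inv₀ one_ne_zero
    refine ((h1'.mul h3').rpow_const (Or.inr (by norm_num))).congr' ?_
    filter_upwards [hζ, hξ, hζ', hξ'] with t h1t h2t h3t h4t
    have e1 : (0 : ℝ) ≤ 2 * (ζ t).im := by positivity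
    have e2 : (0 : ℝ) ≤ 2 * (ξ t).im := by positivity
    have e3 : (0 : ℝ) ≤ 2 * (ζ' t).im := by positivity
    have e4 : (0 : ℝ) ≤ 2 * (ξ' t).im := by positivity
    rw [← Real.mul_rpow e1 e2, ← Real.mul_rpow e3 e4, ← Real.div_rpow (mul_nonneg e1 e2)
      (mul_nonneg e3 e4)]
    congr 1
    field_simp
  have hC : Tendsto (fun t => ‖D₁ t‖ ^ ((1 : ℝ) / 8) * ‖D₂ t‖ ^ ((1 : ℝ) / 8)) l
      (𝓝 (‖(d : ℂ)‖ ^ ((1 : ℝ) / 8) * ‖(1 : ℂ)‖ ^ ((1 : ℝ) / 8))) :=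
    (h2.norm.rpow_const (Or.inr (by norm_num))).mul (h4.norm.rpow_const (Or.inr (by norm_num)))
  -- assembling: `√d · (d⁻¹)^{1/8} · d^{1/8} = d^{1/2}`
  convert (hA.mul hB).mul hC using 2
  rw [inv_one, mul_one, norm_one, Real.one_rpow, mul_one, Complex.norm_real, Real.norm_eq_abs,
    abs_of_pos hd, Real.sqrt_eq_rpow, Real.inv_rpow hd.le, mul_assoc,
    inv_mul_cancel₀ (Real.rpow_pos_of_pos hd _).ne', mul_one]

/-! ### The registered stub -/

/-- **Boundary fusion of CHI's free two-point functions** (registered stub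
`stub_boundaryFusionCore` = `RestrictionMapAtZero → RestrictionMapAtInfty → BoundaryFusion` of the
line `fk-anchor-transfer`). For nested Dobrushin domains `D' ⊆ D` with common marked points near
which they agree, a chordal uniformizer `φ` of `D`, the pulled-back `*`-hull `A` and its restriction
map `Φ` with `Φ'_A(0) = d` (`Negative.starHull_and_deriv_mem`: `A ∈ 𝒬*`, `0 < d`), the ratio of
CHI's free two-point functions of `D'` (chart `Φ ∘ φ⁻¹`) and `D` (chart `φ⁻¹`) tends to `d^{1/2}`
as `(z, w) → (a, b)` inside `D'`: `φ⁻¹ → 0` at `a` and `φ⁻¹ → ∞` at `b` (Carathéodory,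
`IsChordalUniformizing.tendsto_symm_nhds_zero/cocompact`) within `ℍ ∖ A = φ⁻¹(D')`, the chart
derivative `(φ⁻¹)' ≠ 0` cancels by the chain rule, and `tendsto_freeRatio_halfPlane` applies with
the given behaviour of `Φ` at `0` and `∞`. [cite: ChelkakHonglerIzyurovAnnals2015, Thm. 1.1 with eqs. (1.2)–(1.3)] -/
theorem stub_boundaryFusionCore :
    (∀ (A : Set ℂ) (Φ : ConformalEquiv (UpperHalfPlane.upperHalfPlaneSet \ A) UpperHalfPlane.upperHalfPlaneSet)
      (d : ℝ), IsStarHull A → IsRestrictionMap A Φ → HasRestrictionDeriv A Φ d →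
      Tendsto (fun ζ : ℂ => (Φ ζ).im / ζ.im) (𝓝[UpperHalfPlane.upperHalfPlaneSet \ A] 0) (𝓝 d) ∧
      Tendsto (fun ζ : ℂ => deriv (fun x => Φ x) ζ) (𝓝[UpperHalfPlane.upperHalfPlaneSet \ A] 0)
        (𝓝 (d : ℂ))) →
    (∀ (A : Set ℂ) (Φ : ConformalEquiv (UpperHalfPlane.upperHalfPlaneSet \ A) UpperHalfPlane.upperHalfPlaneSet),
      IsStarHull A → IsRestrictionMap A Φ →
      Tendsto (fun ξ : ℂ => (Φ ξ).im / ξ.im)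
        (cocompact ℂ ⊓ 𝓟 (UpperHalfPlane.upperHalfPlaneSet \ A)) (𝓝 1) ∧
      Tendsto (fun ξ : ℂ => deriv (fun x => Φ x) ξ)
        (cocompact ℂ ⊓ 𝓟 (UpperHalfPlane.upperHalfPlaneSet \ A)) (𝓝 1)) →
    ∀ (D D' : DobrushinDomain), D'.carrier ⊆ D.carrier → D'.pt 0 = D.pt 0 → D'.pt 1 = D.pt 1 →
      (∃ ε : ℝ, 0 < ε ∧ D'.carrier ∩ Metric.ball (D.pt 0) ε = D.carrier ∩ Metric.ball (D.pt 0) ε ∧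
        D'.carrier ∩ Metric.ball (D.pt 1) ε = D.carrier ∩ Metric.ball (D.pt 1) ε) →
      ∀ (φ : ConformalEquiv UpperHalfPlane.upperHalfPlaneSet D.carrier), D.IsChordalUniformizing φ →
      ∀ (A : Set ℂ), A = closure (UpperHalfPlane.upperHalfPlaneSet \
          {z | z ∈ UpperHalfPlane.upperHalfPlaneSet ∧ φ z ∈ D'.carrier}) →
      ∀ (Φ : ConformalEquiv (UpperHalfPlane.upperHalfPlaneSet \ A) UpperHalfPlane.upperHalfPlaneSet)
        (d : ℝ), IsRestrictionMap A Φ → HasRestrictionDeriv A Φ d →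
        Tendsto (fun p : ℂ × ℂ => twoPointFreeCHI (fun x => Φ (φ.symm x)) p.1 p.2 /
            twoPointFreeCHI (fun x => φ.symm x) p.1 p.2)
          (𝓝[D'.carrier] (D.pt 0) ×ˢ 𝓝[D'.carrier] (D.pt 1)) (𝓝 (d ^ ((1 : ℝ) / 2))) := by
  intro H0 Hinf D D' hsub h0 h1 hε φ hφ A hA Φ d hΦ hd
  obtain ⟨hstar, hd0, -⟩ := starHull_and_deriv_mem hsub h0 h1 hε hφ hA hΦ hd
  obtain ⟨hI0, hD0⟩ := H0 A Φ d hstar hΦ hd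
  obtain ⟨hI1, hD1⟩ := Hinf A Φ hstar hΦ
  -- `ℍ ∖ A = φ⁻¹(D')`, so `ψ = φ⁻¹` maps `D'` into the (open) domain of `Φ`
  have hU : upperHalfPlaneSet \ A = φ.pullbackDomain D' := by
    rw [hA]
    exact ConformalEquiv.diff_pullbackHull
  have hmaps : MapsTo φ.symm D'.carrier (upperHalfPlaneSet \ A) := by
    rw [hU]
    exact ConformalEquiv.symm_mapsTo_pullbackDomain hsub
  have hUo : IsOpen (upperHalfPlaneSet \ A) := hstar.1.isOpen_diff
  -- Carathéodory: `ψ → 0` at `a` and `ψ → ∞` at `b`, within `ℍ ∖ A`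
  have hψ0 : Tendsto φ.symm (𝓝[D'.carrier] (D.pt 0)) (𝓝[upperHalfPlaneSet \ A] 0) :=
    tendsto_nhdsWithin_iff.2 ⟨hφ.tendsto_symm_nhds_zero.mono_left (nhdsWithin_mono _ hsub),
      eventually_mem_nhdsWithin.mono hmaps⟩
  have hψ1 : Tendsto φ.symm (𝓝[D'.carrier] (D.pt 1))
      (cocompact ℂ ⊓ 𝓟 (upperHalfPlaneSet \ A)) :=
    tendsto_inf.2 ⟨hφ.tendsto_symm_cocompact.mono_left (nhdsWithin_mono _ hsub),
      tendsto_principal.2 (eventually_mem_nhdsWithin.mono hmaps)⟩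
  -- along the product filter
  set F := 𝓝[D'.carrier] (D.pt 0) ×ˢ 𝓝[D'.carrier] (D.pt 1) with hF
  have hZ : Tendsto (fun p : ℂ × ℂ => φ.symm p.1) F (𝓝[upperHalfPlaneSet \ A] 0) :=
    hψ0.comp tendsto_fst
  have hX : Tendsto (fun p : ℂ × ℂ => φ.symm p.2) F
      (cocompact ℂ ⊓ 𝓟 (upperHalfPlaneSet \ A)) :=
    hψ1.comp tendsto_snd
  have hmem : ∀ᶠ p : ℂ × ℂ in F, p.1 ∈ D'.carrier ∧ p.2 ∈ D'.carrier :=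
    prod_mem_prod self_mem_nhdsWithin self_mem_nhdsWithin
  -- the half-plane algebra
  have hlim := tendsto_freeRatio_halfPlane (l := F) (ζ := fun p : ℂ × ℂ => φ.symm p.1)
    (ξ := fun p : ℂ × ℂ => φ.symm p.2) (ζ' := fun p : ℂ × ℂ => Φ (φ.symm p.1))
    (ξ' := fun p : ℂ × ℂ => Φ (φ.symm p.2))
    (D₁ := fun p : ℂ × ℂ => deriv (fun x => Φ x) (φ.symm p.1))
    (D₂ := fun p : ℂ × ℂ => deriv (fun x => Φ x) (φ.symm p.2)) hd0
    (hI0.comp hZ) (hD0.comp hZ) (hI1.comp hX) (hD1.comp hX)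
    (hZ.mono_right nhdsWithin_le_nhds) (hΦ.1.comp hZ) (hΦ.2.comp hX)
    (hX.mono_right inf_le_left)
    (hmem.mono fun p hp => (hmaps hp.1).1) (hmem.mono fun p hp => (hmaps hp.2).1)
    (hmem.mono fun p hp => Φ.mapsTo (hmaps hp.1)) (hmem.mono fun p hp => Φ.mapsTo (hmaps hp.2))
  -- the chain rule for the composite chart `Φ ∘ ψ` on the open set `D ⊇ D'`, and `ψ' ≠ 0`
  have hchain : ∀ z ∈ D'.carrier, deriv (fun x => Φ (φ.symm x)) z =
      deriv (fun x => Φ x) (φ.symm z) * deriv (fun x => φ.symm x) z := fun z hz =>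
    deriv_comp z (Φ.differentiableOn_coe.differentiableAt (hUo.mem_nhds (hmaps hz)))
      (φ.symm.differentiableOn_coe.differentiableAt (D.isOpen.mem_nhds (hsub hz)))
  have hdnz : ∀ z ∈ D'.carrier, deriv (fun x => φ.symm x) z ≠ 0 := fun z hz =>
    Literature.Analysis.Complex.SCV.deriv_ne_zero_of_injOn φ.symm.differentiableOn_coe D.isOpen
      φ.symm.injOn (hsub hz)
  refine hlim.congr' ?_
  filter_upwards [hmem] with p hp
  exact (twoPointFreeCHI_comp_div_eq (Φf := fun x => Φ x) (ψf := fun x => φ.symm x)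
    (hchain p.1 hp.1) (hchain p.2 hp.2) (hdnz p.1 hp.1) (hdnz p.2 hp.2)).symm

end Summit.CriticalPhenomena.SAWScalingLimit.Theorems.IsingBoundaryRatio
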